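/-
Copyright (c) 2026 the pub-hodgecm-mathlib formalisation cell (harness21).  Prover seat hodgecm-mathlib-F0P2-p02 (g14): road «S3-ram» (LEAD F0P3a-plan (g13); owner
F0P3a-p06 (g15); (Cnt2′) chair F0P3a-p07 (g14)), organ «REGION DATA, eigenframe-free» of the type-(2) junction `strataCount_J₀_block`; 2026-09-02.
-/
import Literature.NumberTheory.Automorphic.UnitaryLatticeTreeEngineRowsGenRamified   -- ★ `engineRowGen_odd` (F0P3a-p04 (g19)); brings ★ StarOfInvolution, ★ FixedVertex, ★ Types
import Literature.NumberTheory.Automorphic.UnitaryLatticeTreeApartment             -- ★ `dualLatt_eq_self_of_isSelfDualLattice`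
import Literature.NumberTheory.Automorphic.UnitaryLatticeTreeTypeTwoParent         -- ★ `scaleLattice_one`
import Literature.NumberTheory.Automorphic.UnitaryLatticeTreeFixedVertex            -- ★ `scaleLattice_scaleLattice`, `scaleLattice_mono`, `scaleLattice_le_self_of_v_le_one`
import HarnessLib

/-!
# The lattice graph of a hermitian space — LABELS OF THE OFF-REGION GRANDCHILDREN OF A TOP-LEVEL VERTEX, from the level tokens alone (no eigenframe)
# (Bruhat–Tits 1972 §10; Serre, *Trees* II.1.1; Kottwitz 1986 §3)

Topic `NumberTheory/Automorphic`; namespace `Literature.NumberTheory.Automorphic.UnitaryLatticeTree`.  THEOREMS ONLY (no definition, no instance, no notation, no named fact,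
no `sorry`); kernel lane `--supports stmt-HodgeConjecture-24833`.  Cell `pub/hodgecm-mathlib` (D-0151), crux H413; road «S3-ram» (Literature seeding, count-neutral); the
(Cnt2′) type-(2) assembly of chair F0P3a-p07 (g14): the one NEW organ of the type-(2) junction `strataCount_J₀_block` (this seat) — the `hlab` clause of ★ ENGINE ED. 3 §4
(`strataVec_total_eq_of_localLaw_of_rootRegion_of_labels`) for the root region `R = {fixed ∧ self-dual ∧ LEV(ϖ^{d₀})}`, proved from LEVEL ALGEBRA only (JUNCTION II's
`regionData_of_rows` proved it for the isoceles type-(1) literals from their eigen-geometry).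

THE MATHEMATICS.  `γ ∈ U(σ, J₀)` on `K³`; for a self-dual vertex `v` and a vertex `w` two steps away (`v ~ c ~ w`, `w` self-dual) one has the SANDWICH `ϖ·v ≤ c ≤ w` and
`ϖ·w ≤ c ≤ v` (§1: a neighbour of a self-dual vertex is a sub-lattice containing `ϖ` times it — `c < v = v^♯ ≤ c^♯`, `ϖc^♯ ≤ c`), hence for ANY matrix `X` the LEVEL DROPS BY
AT MOST TWO along the two steps: `X·v ⊆ ϖ^e·v ⇒ X·w ⊆ ϖ^{e−2}·w` (§2).  Applied to `X = Γ − 1` (level `ϖ^{d₀}` at `v`) and `X = (Γ − 1)²` (level `ϖ^{2d₀}` at `v`): a grandchild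
`w` of a top-level vertex carries `LEV[w](ϖ^{d₀−2})` and `LEV₂[w](ϖ^{2d₀−2})` (§3).  With the junction's labels (`dep` capped at `B ≥ d₀`, `rk` by the `LEV₂(ϖ^{2·dep+1})`
token, `cl = ±1` by the class token) and `d₀ = 2mA + 3`: an OFF-REGION (`¬LEV(ϖ^{d₀})`) fixed self-dual grandchild has `dep ∈ {2mA+1, 2mA+2}`; at `2mA+2` (even) its rank
is `2` (★ `engineRowGen_odd`: rank one forces odd depth), at `2mA+1` its rank is `1` (`LEV₂(ϖ^{4mA+4}) ⇒ LEV₂(ϖ^{4mA+3})`) — §4 **`regionData_of_root`**, the label clause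
`(dep w = 2mA+2 ∧ rk w = 2) ∨ (dep w = 2mA+1 ∧ rk w = 1 ∧ (cl w = 1 ∨ cl w = −1))` of ★ JUNCTION II `regionData_of_rows`, for every `γ` (no eigenframe, no `hnorm`, no
tree hypothesis).  HONEST LABEL: HC_CM is proved only modulo the 2 remaining named inputs (hLiu418 24832, h413 24833) until rung 0 closes; nothing printed is asserted here.

## References
* [BruhatTits1972] F. Bruhat, J. Tits, *Groupes réductifs sur un corps local I*, Publ. Math. IHÉS 41 (1972), §10.
* [Serre1980Trees] J.-P. Serre, *Trees* (1980), Ch. II §1.1 (lattices, neighbours).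
* [Kottwitz1986] R. E. Kottwitz, *Base change for unit elements of Hecke algebras*, Compositio Math. 60 (1986), §3.
-/

set_option autoImplicit false

noncomputable section

open scoped Valued WithZero Matrix MatrixGroups
open Classical

namespace Literature.NumberTheory.Automorphic.UnitaryLatticeTree

open Literature.NumberTheory.Automorphic Literature.NumberTheory.Automorphic.HermitianLattice

variable {K : Type*} [Field K] [Valued K ℤᵐ⁰] {σ : K →+* K} {ϖ : K}

/-! ## §1 The sandwich `ϖ·v ≤ c ≤ w`, `ϖ·w ≤ c ≤ v` along two steps from a self-dual vertex -/

/-- **A neighbour of a self-dual vertex is sandwiched**: `v` self-dual, `v ~ c` ⇒ `ϖ·v ≤ c ≤ v` (`c < v = v^♯ ≤ c^♯` and `ϖ·c^♯ ≤ c`). [cite: BruhatTits1972, §10] [cite: Serre1980Trees, II.1.1] -/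
theorem scaleLattice_le_and_le_of_adj_of_isSelfDualLattice (hvσ : ∀ a, Valued.v (σ a) = Valued.v a)
    {v c : {M : Submodule 𝒪[K] (Fin 3 → K) // IsVertex σ ϖ ((StdForm.antidiagonal 3).over K) M}}
    (hv : IsSelfDualLattice σ ϖ ((StdForm.antidiagonal 3).over K) v.1) (hvc : (latticeGraph σ ϖ ((StdForm.antidiagonal 3).over K)).Adj v c) :
    scaleLattice ϖ v.1 ≤ c.1 ∧ c.1 ≤ v.1 := by
  have hlt : c.1 < v.1 := (latticeGraph_adj_iff_lt_of_isSelfDualLattice_of_v hvσ hv).1 hvc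
  obtain ⟨d, hcd⟩ := c.2
  refine ⟨?_, hlt.le⟩
  have h1 : scaleLattice ϖ (dualLatt σ ((StdForm.antidiagonal 3).over K) c.1) ≤ c.1 := scaleLattice_dualLatt_le_of_isVertexLattice hvσ isUnit_det_antidiagonal hcd
  have h2 : v.1 ≤ dualLatt σ ((StdForm.antidiagonal 3).over K) c.1 := by
    have h := dualLatt_antitone σ ((StdForm.antidiagonal 3).over K) hlt.le
    rwa [dualLatt_eq_self_of_isSelfDualLattice hvσ isUnit_det_antidiagonal hv] at h
  exact (scaleLattice_mono ϖ h2).trans h1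

/-- **The sandwich for a grandchild**: `v`, `w` self-dual with `v ~ c ~ w` ⇒ `ϖ·v ≤ w` and `ϖ·w ≤ v`. [cite: BruhatTits1972, §10] [cite: Serre1980Trees, II.1.1] -/
theorem scaleLattice_le_of_adj_adj_of_isSelfDualLattice (hvσ : ∀ a, Valued.v (σ a) = Valued.v a)
    {v c w : {M : Submodule 𝒪[K] (Fin 3 → K) // IsVertex σ ϖ ((StdForm.antidiagonal 3).over K) M}}
    (hv : IsSelfDualLattice σ ϖ ((StdForm.antidiagonal 3).over K) v.1) (hw : IsSelfDualLattice σ ϖ ((StdForm.antidiagonal 3).over K) w.1)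
    (hvc : (latticeGraph σ ϖ ((StdForm.antidiagonal 3).over K)).Adj v c) (hcw : (latticeGraph σ ϖ ((StdForm.antidiagonal 3).over K)).Adj c w) :
    scaleLattice ϖ v.1 ≤ w.1 ∧ scaleLattice ϖ w.1 ≤ v.1 := by
  obtain ⟨h1, h2⟩ := scaleLattice_le_and_le_of_adj_of_isSelfDualLattice hvσ hv hvc
  obtain ⟨h3, h4⟩ := scaleLattice_le_and_le_of_adj_of_isSelfDualLattice hvσ hw hcw.symm
  exact ⟨h1.trans h4, h3.trans h2⟩

/-! ## §2 The level of any operator drops by at most two along the sandwich -/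

/-- Scaling by a higher power of `ϖ` (`|ϖ| ≤ 1`) gives a smaller lattice: `ϖ^{e′}·M ≤ ϖ^e·M` for `e ≤ e′`. [cite: Serre1980Trees, II.1.1] -/
theorem scaleLattice_pow_le_of_le (hϖ1 : Valued.v ϖ ≤ 1) {N : ℕ} (M : Submodule 𝒪[K] (Fin N → K)) {e e' : ℕ} (h : e ≤ e') :
    scaleLattice (ϖ ^ e') M ≤ scaleLattice (ϖ ^ e) M := by
  obtain ⟨f, rfl⟩ := Nat.exists_eq_add_of_le h
  rw [pow_add, ← scaleLattice_scaleLattice]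
  refine scaleLattice_mono _ ?_
  exact scaleLattice_le_self_of_v_le_one (by rw [map_pow]; exact pow_le_one₀ zero_le hϖ1) M

/-- **LEVEL DROP ≤ 2 ALONG THE SANDWICH**: if `ϖ·v ≤ w`, `ϖ·w ≤ v` and `X·v ⊆ ϖ^e·v` (`e ≥ 2`, `ϖ ≠ 0`), then `X·w ⊆ ϖ^{e−2}·w`:
`X·w ⊆ X·ϖ⁻¹v = ϖ⁻¹X·v ⊆ ϖ^{e−1}·v = ϖ^{e−2}·(ϖv) ⊆ ϖ^{e−2}·w`. [cite: Kottwitz1986, §3] [cite: Serre1980Trees, II.1.1] -/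
theorem map_le_scaleLattice_of_sandwich {N : ℕ} (hϖ0 : ϖ ≠ 0) (X : Matrix (Fin N) (Fin N) K) {v w : Submodule 𝒪[K] (Fin N → K)}
    (h1 : scaleLattice ϖ v ≤ w) (h2 : scaleLattice ϖ w ≤ v) {e : ℕ} (he : 2 ≤ e)
    (hX : v.map ((Matrix.toLin' X).restrictScalars 𝒪[K]) ≤ scaleLattice (ϖ ^ e) v) :
    w.map ((Matrix.toLin' X).restrictScalars 𝒪[K]) ≤ scaleLattice (ϖ ^ (e - 2)) w := by
  -- `w ≤ ϖ⁻¹·v`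
  have hw : w ≤ scaleLattice ϖ⁻¹ v := by
    have h := scaleLattice_mono ϖ⁻¹ h2
    rwa [scaleLattice_scaleLattice, inv_mul_cancel₀ hϖ0, scaleLattice_one] at h
  obtain ⟨f, rfl⟩ := Nat.exists_eq_add_of_le he
  calc w.map ((Matrix.toLin' X).restrictScalars 𝒪[K])
      ≤ (scaleLattice ϖ⁻¹ v).map ((Matrix.toLin' X).restrictScalars 𝒪[K]) := Submodule.map_mono hw
    _ = scaleLattice ϖ⁻¹ (v.map ((Matrix.toLin' X).restrictScalars 𝒪[K])) := (scaleLattice_map ϖ⁻¹ X v).symm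
    _ ≤ scaleLattice ϖ⁻¹ (scaleLattice (ϖ ^ (2 + f)) v) := scaleLattice_mono _ hX
    _ = scaleLattice (ϖ ^ f) (scaleLattice ϖ v) := by
        rw [scaleLattice_scaleLattice, scaleLattice_scaleLattice]
        congr 1
        rw [pow_add, pow_two]
        field_simp
    _ ≤ scaleLattice (ϖ ^ (2 + f - 2)) w := by
        rw [Nat.add_sub_cancel_left]
        exact scaleLattice_mono _ h1

/-- **The square of a level-`ϖ^e` operator has level `ϖ^{2e}`**: `X·M ⊆ ϖ^e·M ⇒ X²·M ⊆ ϖ^{2e}·M`. [cite: Kottwitz1986, §3] -/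
theorem map_sq_le_scaleLattice_of_map_le {N : ℕ} (X : Matrix (Fin N) (Fin N) K) {M : Submodule 𝒪[K] (Fin N → K)} {e : ℕ}
    (hX : M.map ((Matrix.toLin' X).restrictScalars 𝒪[K]) ≤ scaleLattice (ϖ ^ e) M) :
    M.map ((Matrix.toLin' (X ^ 2)).restrictScalars 𝒪[K]) ≤ scaleLattice (ϖ ^ (2 * e)) M := by
  have hcomp : (Matrix.toLin' (X ^ 2)).restrictScalars 𝒪[K] = ((Matrix.toLin' X).restrictScalars 𝒪[K]).comp ((Matrix.toLin' X).restrictScalars 𝒪[K]) := by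
    apply LinearMap.ext
    intro x
    simp [pow_two, Matrix.toLin'_mul]
  rw [hcomp, Submodule.map_comp]
  calc (M.map ((Matrix.toLin' X).restrictScalars 𝒪[K])).map ((Matrix.toLin' X).restrictScalars 𝒪[K])
      ≤ (scaleLattice (ϖ ^ e) M).map ((Matrix.toLin' X).restrictScalars 𝒪[K]) := Submodule.map_mono hX
    _ = scaleLattice (ϖ ^ e) (M.map ((Matrix.toLin' X).restrictScalars 𝒪[K])) := (scaleLattice_map _ X M).symm
    _ ≤ scaleLattice (ϖ ^ e) (scaleLattice (ϖ ^ e) M) := scaleLattice_mono _ hX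
    _ = scaleLattice (ϖ ^ (2 * e)) M := by rw [scaleLattice_scaleLattice, ← pow_add, two_mul]

/-! ## §3 Tokens of a grandchild of a top-level self-dual vertex -/

/-- **TOKENS OF A GRANDCHILD OF A TOP-LEVEL VERTEX** (any `γ`, `|ϖ| = exp(−1)`): `v`, `w` self-dual, `v ~ c ~ w`, `LEV[v](ϖ^{d₀})` with `d₀ ≥ 2` ⇒ `LEV[w](ϖ^{d₀−2})` and
`LEV₂[w](ϖ^{2d₀−2})`. [cite: Kottwitz1986, §3] [cite: BruhatTits1972, §10] -/
theorem lev_and_lev₂_of_adj_adj_of_lev (hvσ : ∀ a, Valued.v (σ a) = Valued.v a) (hϖ : Valued.v ϖ = WithZero.exp (-1 : ℤ))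
    (γ : unitaryGroupOfForm σ ((StdForm.antidiagonal 3).over K))
    {v c w : {M : Submodule 𝒪[K] (Fin 3 → K) // IsVertex σ ϖ ((StdForm.antidiagonal 3).over K) M}}
    (hv : IsSelfDualLattice σ ϖ ((StdForm.antidiagonal 3).over K) v.1) (hw : IsSelfDualLattice σ ϖ ((StdForm.antidiagonal 3).over K) w.1)
    (hvc : (latticeGraph σ ϖ ((StdForm.antidiagonal 3).over K)).Adj v c) (hcw : (latticeGraph σ ϖ ((StdForm.antidiagonal 3).over K)).Adj c w)
    {d₀ : ℕ} (hd2 : 2 ≤ d₀)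
    (hvR : v.1.map ((Matrix.toLin' (((γ : GL (Fin 3) K) : Matrix (Fin 3) (Fin 3) K) - 1)).restrictScalars 𝒪[K]) ≤ scaleLattice (ϖ ^ d₀) v.1) :
    w.1.map ((Matrix.toLin' (((γ : GL (Fin 3) K) : Matrix (Fin 3) (Fin 3) K) - 1)).restrictScalars 𝒪[K]) ≤ scaleLattice (ϖ ^ (d₀ - 2)) w.1 ∧
      w.1.map ((Matrix.toLin' ((((γ : GL (Fin 3) K) : Matrix (Fin 3) (Fin 3) K) - 1) ^ 2)).restrictScalars 𝒪[K]) ≤ scaleLattice (ϖ ^ (2 * d₀ - 2)) w.1 := by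
  have hϖ0 : ϖ ≠ 0 := fun h0 => by rw [h0, map_zero] at hϖ; exact WithZero.coe_ne_zero hϖ.symm
  obtain ⟨h1, h2⟩ := scaleLattice_le_of_adj_adj_of_isSelfDualLattice hvσ hv hw hvc hcw
  refine ⟨map_le_scaleLattice_of_sandwich hϖ0 _ h1 h2 hd2 hvR, ?_⟩
  exact map_le_scaleLattice_of_sandwich hϖ0 _ h1 h2 (by omega) (map_sq_le_scaleLattice_of_map_le _ hvR)

/-! ## §4 The region data: labels of the off-region fixed self-dual grandchildren of a region vertex -/

/-- **REGION DATA, EIGENFRAME-FREE** (the `hlab` clause of ★ ENGINE ED. 3 §4 for `R = {fixed ∧ SD ∧ LEV(ϖ^{d₀})}`, `d₀ = 2mA + 3`): for ANY `γ ∈ U(σ, J₀)` over a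
tame-ramified `K` and the junction's labels (`dep` capped at `B ≥ d₀` by `hdep`, `rk` by `hrk`, `cl` by `hcl`), a region vertex `v` and a fixed self-dual grandchild `w ∈ GC v`
OFF the region satisfy `(dep w = 2mA+2 ∧ rk w = 2) ∨ (dep w = 2mA+1 ∧ rk w = 1 ∧ (cl w = 1 ∨ cl w = −1))` — the conclusion of ★ JUNCTION II `regionData_of_rows`, without its
eigen-geometry (§3 tokens + ★ `engineRowGen_odd`). [cite: Kottwitz1986, §3] [cite: BruhatTits1972, §10] [cite: Serre1980Trees, II.1.1] -/
theorem regionData_of_root (hσ : ∀ x, σ (σ x) = x) (hvσ : ∀ a, Valued.v (σ a) = Valued.v a) (hσϖ : σ ϖ = -ϖ)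
    (hϖ : Valued.v ϖ = WithZero.exp (-1 : ℤ)) (hres : ∀ x : K, Valued.v x ≤ 1 → Valued.v (σ x - x) < 1) (h2 : Valued.v (2 : K) = 1) [Finite 𝓀[K]]
    {γ : unitaryGroupOfForm σ ((StdForm.antidiagonal 3).over K)}
    {d₀ : ℕ} (c₁ : K)
    (B : ℕ) (dep rk : {M : Submodule 𝒪[K] (Fin 3 → K) // IsVertex σ ϖ ((StdForm.antidiagonal 3).over K) M} → ℕ) (cl : {M : Submodule 𝒪[K] (Fin 3 → K) // IsVertex σ ϖ ((StdForm.antidiagonal 3).over K) M} → ℤ)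
    (hdep : ∀ w : {M : Submodule 𝒪[K] (Fin 3 → K) // IsVertex σ ϖ ((StdForm.antidiagonal 3).over K) M}, latticeGraphIso σ ϖ ((StdForm.antidiagonal 3).over K) γ w = w → ∀ e, e ≤ dep w ↔ e ≤ B ∧ w.1.map ((Matrix.toLin' (((γ : GL (Fin 3) K) : Matrix (Fin 3) (Fin 3) K) - 1)).restrictScalars 𝒪[K]) ≤ scaleLattice (ϖ ^ e) w.1)
    (hrk : ∀ w : {M : Submodule 𝒪[K] (Fin 3 → K) // IsVertex σ ϖ ((StdForm.antidiagonal 3).over K) M}, rk w = if w.1.map ((Matrix.toLin' ((((γ : GL (Fin 3) K) : Matrix (Fin 3) (Fin 3) K) - 1) ^ 2)).restrictScalars 𝒪[K]) ≤ scaleLattice (ϖ ^ (2 * dep w + 1)) w.1 then 1 else 2)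
    (hcl : ∀ w : {M : Submodule 𝒪[K] (Fin 3 → K) // IsVertex σ ϖ ((StdForm.antidiagonal 3).over K) M}, cl w = if (∃ y ∈ w.1, ∃ a : K, Valued.v a = 1 ∧ Valued.v ((ϖ ^ (dep w))⁻¹ * pairing σ ((StdForm.antidiagonal 3).over K) y ((((γ : GL (Fin 3) K) : Matrix (Fin 3) (Fin 3) K) - 1) *ᵥ y) - (c₁) * a ^ 2) < 1) then (1 : ℤ) else -1)
    (hBd : d₀ ≤ B)
    (GC : {M : Submodule 𝒪[K] (Fin 3 → K) // IsVertex σ ϖ ((StdForm.antidiagonal 3).over K) M} → Set {M : Submodule 𝒪[K] (Fin 3 → K) // IsVertex σ ϖ ((StdForm.antidiagonal 3).over K) M}) (hGC : ∀ v w, w ∈ GC v ↔ ∃ c, ((latticeGraph σ ϖ ((StdForm.antidiagonal 3).over K)).Adj v c ∧ (latticeGraph σ ϖ ((StdForm.antidiagonal 3).over K)).dist ⟨stdLattice K 3, 0, isSelfDualLattice_stdLattice_three_of_v hϖ⟩ c = (latticeGraph σ ϖ ((StdForm.antidiagonal 3).over K)).dist ⟨stdLattice K 3, 0, isSelfDualLattice_stdLattice_three_of_v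 hϖ⟩ v + 1 ∧ c ∈ {v | latticeGraphIso σ ϖ ((StdForm.antidiagonal 3).over K) γ v = v}) ∧
      ((latticeGraph σ ϖ ((StdForm.antidiagonal 3).over K)).Adj c w ∧ (latticeGraph σ ϖ ((StdForm.antidiagonal 3).over K)).dist ⟨stdLattice K 3, 0, isSelfDualLattice_stdLattice_three_of_v hϖ⟩ w = (latticeGraph σ ϖ ((StdForm.antidiagonal 3).over K)).dist ⟨stdLattice K 3, 0, isSelfDualLattice_stdLattice_three_of_v hϖ⟩ c + 1 ∧ w ∈ {v | latticeGraphIso σ ϖ ((StdForm.antidiagonal 3).over K) γ v = v}))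
    (mA : ℕ) (hmA : d₀ = 2 * mA + 3)
    {v : {M : Submodule 𝒪[K] (Fin 3 → K) // IsVertex σ ϖ ((StdForm.antidiagonal 3).over K) M}} (_hfix : latticeGraphIso σ ϖ ((StdForm.antidiagonal 3).over K) γ v = v) (hv : IsSelfDualLattice σ ϖ ((StdForm.antidiagonal 3).over K) v.1) (hvR : v.1.map ((Matrix.toLin' (((γ : GL (Fin 3) K) : Matrix (Fin 3) (Fin 3) K) - 1)).restrictScalars 𝒪[K]) ≤ scaleLattice (ϖ ^ d₀) v.1) :
    ∀ w ∈ GC v, w ∉ {v : {M : Submodule 𝒪[K] (Fin 3 → K) // IsVertex σ ϖ ((StdForm.antidiagonal 3).over K) M} | latticeGraphIso σ ϖ ((StdForm.antidiagonal 3).over K) γ v = v ∧ IsSelfDualLattice σ ϖ ((StdForm.antidiagonal 3).over K) v.1 ∧ v.1.map ((Matrix.toLin' (((γ : GL (Fin 3) K) : Matrix (Fin 3) (Fin 3) K) - 1)).restrictScalars 𝒪[K]) ≤ scaleLattice (ϖ ^ d₀) v.1} →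
      (dep w = 2 * mA + 2 ∧ rk w = 2) ∨ (dep w = 2 * mA + 1 ∧ rk w = 1 ∧ (cl w = 1 ∨ cl w = -1)) := by
  have hϖ1 : Valued.v ϖ ≤ 1 := by rw [hϖ, ← WithZero.exp_zero]; exact WithZero.exp_le_exp.2 (by norm_num)
  intro w hw hwR'
  obtain ⟨c, ⟨hvc, -, -⟩, hcw, -, hwF⟩ := (hGC _ w).1 hw
  have hfixw : latticeGraphIso σ ϖ ((StdForm.antidiagonal 3).over K) γ w = w := hwF
  -- `w` is self-dual (two steps of the alternation)
  have hc : ¬ IsSelfDualLattice σ ϖ ((StdForm.antidiagonal 3).over K) c.1 := (isSelfDualLattice_iff_not_isSelfDualLattice_of_adj_of_v hvσ hϖ hvc).1 hv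
  have hwS : IsSelfDualLattice σ ϖ ((StdForm.antidiagonal 3).over K) w.1 := by
    by_contra h
    exact hc ((isSelfDualLattice_iff_not_isSelfDualLattice_of_adj_of_v hvσ hϖ hcw).2 h)
  -- off the region = `¬LEV[w](ϖ^{d₀})`
  have hwR : ¬ w.1.map ((Matrix.toLin' (((γ : GL (Fin 3) K) : Matrix (Fin 3) (Fin 3) K) - 1)).restrictScalars 𝒪[K]) ≤ scaleLattice (ϖ ^ d₀) w.1 :=
    fun h => hwR' ⟨hfixw, hwS, h⟩
  -- the tokens of §3
  obtain ⟨hlev, hlev₂⟩ := lev_and_lev₂_of_adj_adj_of_lev hvσ hϖ γ hv hwS hvc hcw (by omega) hvR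
  -- `2mA + 1 ≤ dep w ≤ 2mA + 2`
  have hge : 2 * mA + 1 ≤ dep w := (hdep w hfixw (2 * mA + 1)).2 ⟨by omega, by rw [show 2 * mA + 1 = d₀ - 2 by omega]; exact hlev⟩
  have hle : dep w ≤ 2 * mA + 2 := by
    by_contra hlt
    have h := ((hdep w hfixw d₀).1 (by omega)).2
    exact hwR h
  rcases (show dep w = 2 * mA + 1 ∨ dep w = 2 * mA + 2 by omega) with hd | hd
  · -- odd depth `2mA+1`: rank one by the `LEV₂` token
    refine Or.inr ⟨hd, ?_, ?_⟩
    · rw [hrk w, if_pos]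
      rw [hd]
      refine hlev₂.trans (scaleLattice_pow_le_of_le hϖ1 _ (by omega))
    · rw [hcl w]; split_ifs <;> simp
  · -- even depth `2mA+2`: rank two (rank one forces odd depth, ★ `engineRowGen_odd`)
    refine Or.inl ⟨hd, ?_⟩
    by_contra hrk2
    have hrk1 : rk w = 1 := by
      have h := hrk w
      split_ifs at h with hc'
      · exact h
      · exact absurd h hrk2
    have hodd := engineRowGen_odd hσ hvσ hσϖ hϖ hres h2 (D := d₀) B dep rk hdep hrk hBd w hwF hwS (by omega) (by omega) hrk1
    rw [hd] at hodd
    exact (Nat.not_even_iff_odd.2 hodd) (by exact ⟨mA + 1, by ring⟩)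

end Literature.NumberTheory.Automorphic.UnitaryLatticeTree

end
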